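import Summits.AtomisticToContinuum.HydrodynamicLimit.Theorems.OneFlightGossipEngineOneFlightLayeredChaosNoWrap
import HarnessLib

/-!
# `OneFlightGossipEngine.OneFlightLayeredChaos` — no wrap-around inside the kinetic window, free threshold
(crux stmt-AtomisticToContinuum-14535, line `Sketch`, lead cycle c3; registered stub `noWrap_of_threshold`)

Generalisation of `Theorems.stub_noWrap` (threshold `1/4`,
`Theorems/OneFlightGossipEngineOneFlightLayeredChaosNoWrap.lean`) to an arbitrary path-length threshold `c > 0`.
Under the global Gibbs law `P = localGibbsLaw σ 1 0 θ₀ N Φ` of `N + 1` hard spheres of diameter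
`ε_N = σ (N+1)^{-1/3}` on the unit torus with Maxwellian `N(0, θ₀ I)` velocities, inside the kinetic window
`(0, w]`, `w = τ (N+1)^{-1/3}`, NO particle has (`lintegral`) path length `≥ c`, with `P`-probability `≥ 1 − δ`
for `N ≥ N₀(θ₀, c, τ, δ)`:

`P {z | ∃ k, c ≤ ∫⁻_{(0,w]} ‖v_k(Φ_t z)‖ dt} ≤ δ`.

Proof: the one-particle argument of the `c = 1/4` file, re-run with the truncation level `V = c/(2w)` in place of
`1/(8w)` (`NoWrap.measure_longPath_particle_le_of_threshold`): the pointwise split `‖v‖ ≤ V + ‖v‖ 𝟙{V ≤ ‖v‖}`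
(`NoWrap.ofReal_norm_le_add_speedTail`) shows that `c ≤ ∫⁻ ‖v_k‖` forces
`c/2 ≤ F(z) := ∫⁻_{(0,w]} ‖v_k‖ 𝟙{V ≤ ‖v_k‖} ∘ Φ_t`; Markov (`meas_ge_le_lintegral_div`, `F` a.e.-measurable by
`NoWrap.aemeasurable_setLIntegral_comp_flow`); Tonelli + stationarity
(`AntiMazurCertificate.lintegral_setLIntegral_comp_flow`,
`BoltzmannGreenKuboOrthMomentum.measurePreserving_flow_localGibbsLaw`); Maxwellian one-body marginal
(`LoschmidtTagging.lintegral_vel_localGibbsLaw_const`) and the quartic tail bound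
`∫ ‖v‖ 𝟙{V ≤ ‖v‖} dN(0,θ₀) ≤ V⁻³ M₄` (`NoWrap.lintegral_speedTail_gauss_le`): one particle costs
`(2/c) · w · M₄ / V³ = (2/c)⁴ M₄ w⁴`; the union bound over the `N + 1` particles totals
`(2/c)⁴ M₄ τ⁴ (N+1)^{-1/3} → 0` (`NoWrap.exists_nat_mul_rpow_le`).

References: C. Cercignani, R. Illner, M. Pulvirenti, *The Mathematical Theory of Dilute Gases* (1994) §4.2
(Maxwellian velocity tails under the equilibrium measure); H. Spohn, *Large Scale Dynamics of Interacting
Particles* (1991) Part I §2.3.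
-/

open scoped BigOperators ENNReal
open MeasureTheory ProbabilityTheory Set Filter Topology
open Literature.Analysis.FluidPDE Literature.MathematicalPhysics.KineticTheory

namespace Summit.AtomisticToContinuum.HydrodynamicLimit.Theorems

noncomputable section

namespace NoWrap

/-- **Long path of one particle is unlikely (free threshold).** For `c > 0`, `w > 0` and every particle `k`,
`P {z | c ≤ ∫⁻_{(0,w]} ‖v_k(Φ_t z)‖ dt} ≤ (2/c)⁴ M₄ w⁴`, `M₄ = ∫ ‖v‖⁴ dN(0, θ₀ I₃)`: split the speed at
`V = c/(2w)` (the slow part integrates to `≤ c/2`), Markov at level `c/2` for the window integral of the truncated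
speed, Tonelli + stationarity, Maxwellian one-body marginal, quartic-moment tail bound. [folklore] -/
theorem measure_longPath_particle_le_of_threshold {θ₀ : ℝ} (hθ : 0 < θ₀) {c : ℝ} (hc : 0 < c) {σ : ℝ}
    (hσ2 : σ ≤ 2⁻¹) (N : ℕ) (Φ : HardSphereFlow (Torus.geometry (Fin 3)) (hsDiameter σ N) (N + 1))
    (k : Fin (N + 1)) {w : ℝ} (hw : 0 < w) :
    localGibbsLaw σ (fun _ => 1) (fun _ => 0) (fun _ => θ₀) N Φ
        {z | ENNReal.ofReal c ≤ ∫⁻ t in Ioc 0 w, ENNReal.ofReal ‖(Φ.flow t z k).2‖} ≤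
      ENNReal.ofReal ((2 / c) ^ 4 * (∫ v, ‖v‖ ^ 4 ∂(gaussMeasure (0 : V3) θ₀)) * w ^ 4) := by
  set P := localGibbsLaw σ (fun _ => 1) (fun _ => 0) (fun _ => θ₀) N Φ with hP
  set M : ℝ := ∫ v, ‖v‖ ^ 4 ∂(gaussMeasure (0 : V3) θ₀) with hM
  haveI : IsProbabilityMeasure P :=
    isProbabilityMeasure_localGibbsLaw continuous_const continuous_const continuous_const
      (fun _ => one_pos) (fun _ => hθ) (by linarith) N Φ
  have hσ' : σ ≤ 1 / 2 := by linarith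
  have hc2 : 0 < c / 2 := by positivity
  -- the truncation level
  set V : ℝ := c / (2 * w) with hV
  have hV0 : 0 < V := by positivity
  have hVw : V * w = c / 2 := by
    rw [hV]
    field_simp
  -- the truncated speed, the one-body observable and its window functional
  set H : V3 → ℝ≥0∞ := {v : V3 | V ≤ ‖v‖}.indicator fun v => ENNReal.ofReal ‖v‖ with hHdef
  have hH : Measurable H := measurable_speedTail V
  set G : Config (N + 1) (Fin 3) T3 → ℝ≥0∞ := fun y => H ((y k).2) with hGdef
  have hG : Measurable G := hH.comp (measurable_pi_apply k).snd
  set F : Config (N + 1) (Fin 3) T3 → ℝ≥0∞ := fun z => ∫⁻ t in Ioc 0 w, G (Φ.flow t z) with hFdef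
  have hF : AEMeasurable F P := aemeasurable_setLIntegral_comp_flow hθ hσ2 N Φ hG 0 w
  -- (2) truncation: a long path forces a large window integral of the truncated speed
  have hsub : {z | ENNReal.ofReal c ≤ ∫⁻ t in Ioc 0 w, ENNReal.ofReal ‖(Φ.flow t z k).2‖} ⊆
      {z | ENNReal.ofReal (c / 2) ≤ F z} := by
    intro z hz
    simp only [Set.mem_setOf_eq] at hz ⊢
    by_contra hlt
    rw [not_le] at hlt
    have hle : ∫⁻ t in Ioc 0 w, ENNReal.ofReal ‖(Φ.flow t z k).2‖ ≤ ENNReal.ofReal (c / 2) + F z := by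
      calc ∫⁻ t in Ioc 0 w, ENNReal.ofReal ‖(Φ.flow t z k).2‖
          ≤ ∫⁻ t in Ioc 0 w, (ENNReal.ofReal V + G (Φ.flow t z)) :=
            lintegral_mono fun t => ofReal_norm_le_add_speedTail V _
        _ = ENNReal.ofReal V * volume (Ioc (0 : ℝ) w) + F z := by
            rw [lintegral_add_left measurable_const, setLIntegral_const]
        _ = ENNReal.ofReal (c / 2) + F z := by
            rw [Real.volume_Ioc, sub_zero, ← ENNReal.ofReal_mul hV0.le, hVw]
    have hlt2 : ENNReal.ofReal (c / 2) + F z < ENNReal.ofReal (c / 2) + ENNReal.ofReal (c / 2) :=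
      ENNReal.add_lt_add_left ENNReal.ofReal_ne_top hlt
    have hcc : ENNReal.ofReal (c / 2) + ENNReal.ofReal (c / 2) = ENNReal.ofReal c := by
      rw [← ENNReal.ofReal_add hc2.le hc2.le, add_halves]
    rw [hcc] at hlt2
    exact absurd (hz.trans hle) (not_le.2 hlt2)
  -- (4)+(5) Tonelli and stationarity, (6) Maxwellian marginal
  have hFint : ∫⁻ z, F z ∂P = ENNReal.ofReal w * ∫⁻ v, H v ∂(gaussMeasure (0 : V3) θ₀) := by
    have h45 : ∫⁻ z, F z ∂P = volume (Ioc (0 : ℝ) w) * ∫⁻ z, G z ∂P :=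
      AntiMazurCertificate.lintegral_setLIntegral_comp_flow Φ P
        (fun t => BoltzmannGreenKuboOrthMomentum.measurePreserving_flow_localGibbsLaw 1 θ₀ 0 Φ t)
        (OLC.localGibbsLaw_one_compl_good σ θ₀ N Φ) hG 0 w
    have h6 : ∫⁻ z, G z ∂P = ∫⁻ v, H v ∂(gaussMeasure (0 : V3) θ₀) :=
      LoschmidtTagging.lintegral_vel_localGibbsLaw_const (H := H) hσ' one_pos hθ N Φ k hH
    rw [h45, h6, Real.volume_Ioc, sub_zero]
  -- (3) Markov and assembly
  have hc2' : ENNReal.ofReal (c / 2) ≠ 0 := (ENNReal.ofReal_pos.2 hc2).ne'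
  calc P {z | ENNReal.ofReal c ≤ ∫⁻ t in Ioc 0 w, ENNReal.ofReal ‖(Φ.flow t z k).2‖}
      ≤ P {z | ENNReal.ofReal (c / 2) ≤ F z} := measure_mono hsub
    _ ≤ (∫⁻ z, F z ∂P) / ENNReal.ofReal (c / 2) := meas_ge_le_lintegral_div hF hc2' ENNReal.ofReal_ne_top
    _ = (ENNReal.ofReal w * ∫⁻ v, H v ∂(gaussMeasure (0 : V3) θ₀)) / ENNReal.ofReal (c / 2) := by
        rw [hFint]
    _ ≤ (ENNReal.ofReal w * ENNReal.ofReal (M / V ^ 3)) / ENNReal.ofReal (c / 2) := by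
        gcongr
        exact lintegral_speedTail_gauss_le θ₀ hV0
    _ = ENNReal.ofReal (w * (M / V ^ 3) / (c / 2)) := by
        rw [← ENNReal.ofReal_mul hw.le]
        exact (ENNReal.ofReal_div_of_pos hc2).symm
    _ = ENNReal.ofReal ((2 / c) ^ 4 * M * w ^ 4) := by
        congr 1
        rw [hV]
        field_simp

end NoWrap

open NoWrap in
/-- **No wrap-around at a free threshold: inside the kinetic window no particle travels `c`** (registered stub
`noWrap_of_threshold` of crux stmt-AtomisticToContinuum-14535, line `Sketch`). Under the global Gibbs law
`P = localGibbsLaw σ 1 0 θ₀ N Φ`, for every `c > 0`, `N ≥ N₀(θ₀, c, τ, δ)` and `w = τ (N+1)^{-1/3}`: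
`P {z | ∃ k, c ≤ ∫⁻_{(0,w]} ‖v_k(Φ_t z)‖ dt} ≤ δ`. Union bound over the `N + 1` particles
(`measure_iUnion_fintype_le`) and the one-particle bound `(2/c)⁴ M₄ w⁴`
(`NoWrap.measure_longPath_particle_le_of_threshold`); the total
`(N+1) (2/c)⁴ M₄ τ⁴ (N+1)^{-4/3} = (2/c)⁴ M₄ τ⁴ (N+1)^{-1/3}` is `≤ δ` for large `N`
(`NoWrap.exists_nat_mul_rpow_le`). The disc transfer of the line consumes the case `c = 1/8`. [folklore] -/
theorem noWrap_of_threshold : ∀ {θ₀ : ℝ}, 0 < θ₀ → ∀ {c : ℝ}, 0 < c → ∀ {σ : ℝ}, 0 < σ → σ ≤ 2⁻¹ → ∀ {τ : ℝ}, 0 < τ → ∀ {δ : ℝ}, 0 < δ → ∃ N₀ : ℕ, ∀ N : ℕ, N₀ ≤ N → ∀ Φ : Literature.Analysis.FluidPDE.HardSphereFlow (Literature.Analysis.FluidPDE.Torus.geometry (Fin 3)) (Literature.MathematicalPhysics.KineticTheory.hsDiameter σ N) (N + 1), Literature.MathematicalPhysics.KineticTheory.localGibbsLaw σ (fun _ =>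 1) (fun _ => 0) (fun _ => θ₀) N Φ {z | ∃ k : Fin (N + 1), ENNReal.ofReal c ≤ ∫⁻ t in Set.Ioc 0 (τ * ((N + 1 : ℕ) : ℝ) ^ (-(1 / 3 : ℝ))), ENNReal.ofReal ‖(Φ.flow t z k).2‖} ≤ ENNReal.ofReal δ := by
  intro θ₀ hθ c hc σ hσ hσ2 τ hτ δ hδ
  have _hσ0 := hσ
  set M : ℝ := ∫ v, ‖v‖ ^ 4 ∂(gaussMeasure (0 : V3) θ₀) with hM
  obtain ⟨N₀, hN₀⟩ := exists_nat_mul_rpow_le ((2 / c) ^ 4 * M * τ ^ 4) hδ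
  refine ⟨N₀, fun N hN Φ => ?_⟩
  have hNb := hN₀ N hN
  set n : ℝ := ((N + 1 : ℕ) : ℝ) with hn
  have hn0 : 0 < n := by
    rw [hn]
    positivity
  set x : ℝ := n ^ (-(1 / 3 : ℝ)) with hx
  have hx0 : 0 < x := Real.rpow_pos_of_pos hn0 _
  have hx3 : n * x ^ 3 = 1 := by
    have h : x ^ 3 = n⁻¹ := by
      rw [hx, ← Real.rpow_natCast, ← Real.rpow_mul hn0.le,
        show (-(1 / 3 : ℝ)) * ((3 : ℕ) : ℝ) = -1 by norm_num, Real.rpow_neg_one]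
    rw [h, mul_inv_cancel₀ hn0.ne']
  have hw0 : 0 < τ * x := mul_pos hτ hx0
  -- union bound over the particles
  have hS : {z : Config (N + 1) (Fin 3) T3 | ∃ k : Fin (N + 1), ENNReal.ofReal c ≤
        ∫⁻ t in Set.Ioc 0 (τ * x), ENNReal.ofReal ‖(Φ.flow t z k).2‖} =
      ⋃ k : Fin (N + 1), {z | ENNReal.ofReal c ≤
        ∫⁻ t in Set.Ioc 0 (τ * x), ENNReal.ofReal ‖(Φ.flow t z k).2‖} := by
    ext z
    simp only [Set.mem_setOf_eq, Set.mem_iUnion]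
  -- the real bookkeeping: `(N+1) · (2/c)⁴ M (τ x)⁴ = (2/c)⁴ M τ⁴ x` since `(N+1) x³ = 1`
  have hnb : n * ((2 / c) ^ 4 * M * (τ * x) ^ 4) = (2 / c) ^ 4 * M * τ ^ 4 * x := by
    calc n * ((2 / c) ^ 4 * M * (τ * x) ^ 4) = (2 / c) ^ 4 * M * τ ^ 4 * x * (n * x ^ 3) := by ring
      _ = (2 / c) ^ 4 * M * τ ^ 4 * x := by rw [hx3, mul_one]
  calc localGibbsLaw σ (fun _ => 1) (fun _ => 0) (fun _ => θ₀) N Φ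
        {z | ∃ k : Fin (N + 1), ENNReal.ofReal c ≤
          ∫⁻ t in Set.Ioc 0 (τ * x), ENNReal.ofReal ‖(Φ.flow t z k).2‖}
      = localGibbsLaw σ (fun _ => 1) (fun _ => 0) (fun _ => θ₀) N Φ
          (⋃ k : Fin (N + 1), {z | ENNReal.ofReal c ≤
            ∫⁻ t in Set.Ioc 0 (τ * x), ENNReal.ofReal ‖(Φ.flow t z k).2‖}) := by rw [hS]
    _ ≤ ∑ k : Fin (N + 1), localGibbsLaw σ (fun _ => 1) (fun _ => 0) (fun _ => θ₀) N Φ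
          {z | ENNReal.ofReal c ≤ ∫⁻ t in Set.Ioc 0 (τ * x), ENNReal.ofReal ‖(Φ.flow t z k).2‖} :=
        measure_iUnion_fintype_le _ _
    _ ≤ ∑ _k : Fin (N + 1), ENNReal.ofReal ((2 / c) ^ 4 * M * (τ * x) ^ 4) :=
        Finset.sum_le_sum fun k _ => measure_longPath_particle_le_of_threshold hθ hc hσ2 N Φ k hw0
    _ = ENNReal.ofReal (n * ((2 / c) ^ 4 * M * (τ * x) ^ 4)) := by
        rw [Finset.sum_const, Finset.card_univ, Fintype.card_fin, nsmul_eq_mul,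
          ENNReal.ofReal_mul hn0.le, hn, ENNReal.ofReal_natCast]
    _ ≤ ENNReal.ofReal δ := by
        refine ENNReal.ofReal_le_ofReal ?_
        rw [hnb]
        exact hNb

end

end Summit.AtomisticToContinuum.HydrodynamicLimit.Theorems
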